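import Mathlib.Analysis.SpecialFunctions.Integrals.Basic
import Mathlib.Analysis.SpecialFunctions.Trigonometric.InverseDeriv
import Mathlib.Analysis.SpecialFunctions.Trigonometric.ArctanDeriv
import Mathlib.Analysis.SpecialFunctions.Sqrt
import Mathlib.MeasureTheory.Integral.IntervalIntegral.FundThmCalculus
import HarnessLib

/-!
# Boltzmann's `B₄` for hard spheres — the two-centre integral, I: opposite-side inner integral

Towards the discharge of the named facts
`Literature.MathematicalPhysics.StatisticalMechanics.Boltzmann1899_B4_hardSpheres_dim3`
(`BoltzmannB4HardSpheres.lean`) and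
`Literature.MathematicalPhysics.StatisticalMechanics.HardSphereVirial.hardSphere_B4`
(`HardSphereVirialCoefficients.lean`): the tree already reduces both
(`BoltzmannB4HardSpheresProofs.lean`, `volume_hardSphereStarFour_eq_integral`) to the double
integral `J = ∫_{1/2}^1 ∫_{1/2}^1 (gs u v + go u v) dv du` of the two disc-pair measures of
Lyberg's cylindrical reduction [Lyberg2005, §3] (Nijboer–van Hove's `χ(1)`), whose closed form is
Boltzmann's `J = π·(−(89/1260)π − (73/1680)√2 + (459/1120)·arccos(1/3))`.

This file evaluates, in closed form and by an explicit antiderivative, the INNER integral of the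
OPPOSITE-SIDE integrand. For `u, v ∈ (1/2, 1)` put `P = 1 − u²`, `Q = 1 − v²`,
`R = 1 − (u+v−1)²` (squared radii of the two lens slices and squared admissible transverse
distance) and let `A, B, C` be the angles of the triangle with sides `√P, √Q, √R`; its Heron
quantity is `H = 4QR − (Q+R−P)² = 8(u+v)(1−u)(1−v)`, so that with `γ = √((1−u)/2)` and
`S = √(1−v)√(u+v)` one has `√H = 4γS` and the remarkable forms
`A = π/2 − arctan(S/(2γ))`, `B = arctan(√(1−v)/(γ√(u+v)))`, `C = π/2 − arctan(γ√(1−v)/√(u+v))`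
(`angAo`, `angBo`, `angCo`). The integrand is
`k_o = QR·A + PR·B + PQ·C − (P+Q+R)·γS` (`kOpp`; `= go/π`, proved in part IV), and

* `hasDerivAt_FinOpp` : `∂/∂v FinOpp = k_o` on `(1/2,1)²`, where `FinOpp` (integration by parts on
  the three angle terms with polynomial antiderivatives `F₁, F₂, F₃` vanishing at `v = 1`, then the
  algebraic remainder `γ(PS·S + cI·arcsin a₀) + (α·arcsin a₁ + β·arcsin a₂)/2` with
  `a₀ = (1−u−2v)/(1+u)`, `a₁ = (1−3u−3v+uv)/((1+v)(1+u))`, `a₂ = (2−u+u²−3v+uv)/((2−u−v)(1+u))`,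
  the last two being the poles `v = −1`, `v = 2 − u` of the remainder);
* `integral_kOpp` : `∫_{1/2}^1 k_o(u,v) dv = FinOpp u 1 − FinOpp u (1/2)` (FTC);
* `FinOpp_one` : the value at `v = 1`.

All identities are finite algebraic certificates (`field_simp`/`ring` after isolating the square
roots); the decomposition was found with a computer algebra computation and is recorded in the
definitions. Parts II–IV (same-side inner integral, the outer `u`-integrals, assembly) follow in
sibling files.

## References

* I. Lyberg, *The fourth virial coefficient of a fluid of hard spheres in odd dimensions*,
  J. Stat. Phys. 119 (2005) 747–764, §3 ("After integration by parts, this gives integrals of the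
  type `∫ p(x)/(q(x)√(a+bx+cx²)) dx`"). [Lyberg2005]
* B. R. A. Nijboer, L. van Hove, Phys. Rev. 85 (1952) 777–783. [NijboerVanhove1952]
-/

noncomputable section

open Real Set MeasureTheory intervalIntegral

namespace Literature.MathematicalPhysics.StatisticalMechanics

namespace BoltzmannB4.TwoCentre

/-! ### Square roots and their derivatives -/

/-- `d/dv √(1 − v) = −1/(2√(1−v))` for `v < 1`. [folklore] -/
theorem hasDerivAt_sqrt_one_sub {v : ℝ} (hv : v < 1) :
    HasDerivAt (fun v : ℝ => √(1 - v)) (-1 / (2 * √(1 - v))) v := by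
  have h : HasDerivAt (fun v : ℝ => 1 - v) (-1) v := by
    simpa using (hasDerivAt_id v).const_sub 1
  convert h.sqrt (by linarith) using 1

/-- `d/dv √(u + v) = 1/(2√(u+v))` for `u + v > 0`. [folklore] -/
theorem hasDerivAt_sqrt_add {u v : ℝ} (huv : 0 < u + v) :
    HasDerivAt (fun v : ℝ => √(u + v)) (1 / (2 * √(u + v))) v := by
  have h : HasDerivAt (fun v : ℝ => u + v) 1 v := by
    simpa using (hasDerivAt_id v).const_add u
  convert h.sqrt (by linarith) using 1

/-- The constant `γ(u) = √((1 − u)/2)` (one quarter of `√H` divided by `√((1−v)(u+v))` in the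
opposite-side configuration). [folklore] -/
def gam (u : ℝ) : ℝ := √((1 - u) / 2)

/-- `γ > 0` for `u < 1`. [folklore] -/
theorem gam_pos {u : ℝ} (hu : u < 1) : 0 < gam u := Real.sqrt_pos.mpr (by linarith)

/-- `γ² = (1 − u)/2` for `u < 1`. [folklore] -/
theorem gam_sq {u : ℝ} (hu : u < 1) : gam u ^ 2 = (1 - u) / 2 := Real.sq_sqrt (by linarith)

/-! ### The three angles of the opposite-side triangle (sides `√(1−u²)`, `√(1−v²)`,
`√(1−(u+v−1)²)`), in arctangent form -/

/-- Angle opposite the side `√(1 − u²)`: `A = π/2 − arctan(√(1−v)√(u+v)/(2γ))`. [folklore] -/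
def angAo (u v : ℝ) : ℝ := π / 2 - arctan (√(1 - v) * √(u + v) / (2 * gam u))

/-- Angle opposite the side `√(1 − v²)`: `B = arctan(√(1−v)/(γ √(u+v)))`. [folklore] -/
def angBo (u v : ℝ) : ℝ := arctan (√(1 - v) / (gam u * √(u + v)))

/-- Angle opposite the side `√(1 − (u+v−1)²)`: `C = π/2 − arctan(γ √(1−v)/√(u+v))`. [folklore] -/
def angCo (u v : ℝ) : ℝ := π / 2 - arctan (gam u * √(1 - v) / √(u + v))

/-- `∂A/∂v = γ(u+2v−1)/((1+v)(2−u−v)√(1−v)√(u+v))`. [folklore] -/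
theorem hasDerivAt_angAo {u v : ℝ} (hu : u < 1) (hv : v < 1) (huv : 0 < u + v) :
    HasDerivAt (angAo u) (gam u * (u + 2 * v - 1) /
      ((1 + v) * (2 - u - v) * (√(1 - v) * √(u + v)))) v := by
  have hY : 0 < √(1 - v) := Real.sqrt_pos.mpr (by linarith)
  have hZ : 0 < √(u + v) := Real.sqrt_pos.mpr huv
  have hg : 0 < gam u := gam_pos hu
  have hY2 : √(1 - v) ^ 2 = 1 - v := Real.sq_sqrt (by linarith)
  have hZ2 : √(u + v) ^ 2 = u + v := Real.sq_sqrt huv.le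
  have hg2 := gam_sq hu
  have h1 : HasDerivAt (fun v => √(1 - v) * √(u + v) / (2 * gam u))
      ((-1 / (2 * √(1 - v)) * √(u + v) + √(1 - v) * (1 / (2 * √(u + v)))) / (2 * gam u)) v :=
    ((hasDerivAt_sqrt_one_sub hv).mul (hasDerivAt_sqrt_add huv)).div_const _
  have h2 := (h1.arctan).const_sub (π / 2)
  unfold angAo
  refine h2.congr_deriv ?_
  set Y := √(1 - v) with hYdef
  set Z := √(u + v) with hZdef
  set g := gam u with hgdef
  have hE : (1 + v) * (2 - u - v) ≠ 0 := by
    apply mul_ne_zero <;> linarith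
  have key : 4 * g ^ 2 + Y ^ 2 * Z ^ 2 = (1 + v) * (2 - u - v) := by
    rw [hg2, hY2, hZ2]; ring
  have key2 : Z ^ 2 - Y ^ 2 = u + 2 * v - 1 := by rw [hY2, hZ2]; ring
  have hden : 1 + (Y * Z / (2 * g)) ^ 2 = (1 + v) * (2 - u - v) / (4 * g ^ 2) := by
    rw [← key]; field_simp; ring
  rw [hden]
  field_simp
  have : -Z ^ 2 + Y ^ 2 = -(u + 2 * v - 1) := by linarith [key2]
  rw [this]
  ring

/-- `∂B/∂v = −γ/((2−u−v)√(1−v)√(u+v))`. [folklore] -/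
theorem hasDerivAt_angBo {u v : ℝ} (hu : u < 1) (hv : v < 1) (huv : 0 < u + v) :
    HasDerivAt (angBo u) (-gam u / ((2 - u - v) * (√(1 - v) * √(u + v)))) v := by
  have hY : 0 < √(1 - v) := Real.sqrt_pos.mpr (by linarith)
  have hZ : 0 < √(u + v) := Real.sqrt_pos.mpr huv
  have hg : 0 < gam u := gam_pos hu
  have hY2 : √(1 - v) ^ 2 = 1 - v := Real.sq_sqrt (by linarith)
  have hZ2 : √(u + v) ^ 2 = u + v := Real.sq_sqrt huv.le
  have hg2 := gam_sq hu
  have h1 : HasDerivAt (fun v => √(1 - v) / (gam u * √(u + v)))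
      (((-1 / (2 * √(1 - v))) * (gam u * √(u + v)) - √(1 - v) * (gam u * (1 / (2 * √(u + v))))) /
        (gam u * √(u + v)) ^ 2) v :=
    (hasDerivAt_sqrt_one_sub hv).div ((hasDerivAt_sqrt_add huv).const_mul (gam u))
      (mul_ne_zero hg.ne' hZ.ne')
  have h2 := h1.arctan
  unfold angBo
  refine h2.congr_deriv ?_
  set Y := √(1 - v) with hYdef
  set Z := √(u + v) with hZdef
  set g := gam u with hgdef
  have hE : (1 + u) * (2 - u - v) ≠ 0 := by
    apply mul_ne_zero <;> linarith
  have key : g ^ 2 * Z ^ 2 + Y ^ 2 = (1 + u) * (2 - u - v) / 2 := by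
    rw [hg2, hY2, hZ2]; ring
  have key2 : Z ^ 2 + Y ^ 2 = 1 + u := by rw [hY2, hZ2]; ring
  have hden : 1 + (Y / (g * Z)) ^ 2 = (1 + u) * (2 - u - v) / (2 * g ^ 2 * Z ^ 2) := by
    field_simp
    linear_combination 2 * key
  rw [hden]
  field_simp
  have h1u : (1 + u) ≠ 0 := by linarith
  have h2uv : (2 - u - v) ≠ 0 := by linarith
  rw [show -Z ^ 2 - Y ^ 2 = -(1 + u) by linarith [key2]]
  field_simp

/-- `∂C/∂v = γ/((1+v)√(1−v)√(u+v))`. [folklore] -/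
theorem hasDerivAt_angCo {u v : ℝ} (hu : u < 1) (hv : v < 1) (huv : 0 < u + v) :
    HasDerivAt (angCo u) (gam u / ((1 + v) * (√(1 - v) * √(u + v)))) v := by
  have hY : 0 < √(1 - v) := Real.sqrt_pos.mpr (by linarith)
  have hZ : 0 < √(u + v) := Real.sqrt_pos.mpr huv
  have hg : 0 < gam u := gam_pos hu
  have hY2 : √(1 - v) ^ 2 = 1 - v := Real.sq_sqrt (by linarith)
  have hZ2 : √(u + v) ^ 2 = u + v := Real.sq_sqrt huv.le
  have hg2 := gam_sq hu
  have h1 : HasDerivAt (fun v => gam u * √(1 - v) / √(u + v))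
      ((gam u * (-1 / (2 * √(1 - v))) * √(u + v) - gam u * √(1 - v) * (1 / (2 * √(u + v)))) /
        √(u + v) ^ 2) v :=
    ((hasDerivAt_sqrt_one_sub hv).const_mul (gam u)).div (hasDerivAt_sqrt_add huv) hZ.ne'
  have h2 := (h1.arctan).const_sub (π / 2)
  unfold angCo
  refine h2.congr_deriv ?_
  set Y := √(1 - v) with hYdef
  set Z := √(u + v) with hZdef
  set g := gam u with hgdef
  have key : Z ^ 2 + g ^ 2 * Y ^ 2 = (1 + u) * (1 + v) / 2 := by
    rw [hg2, hY2, hZ2]; ring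
  have key2 : Z ^ 2 + Y ^ 2 = 1 + u := by rw [hY2, hZ2]; ring
  have hden : 1 + (g * Y / Z) ^ 2 = (1 + u) * (1 + v) / (2 * Z ^ 2) := by
    field_simp
    linear_combination 2 * key
  rw [hden]
  field_simp
  have h1u : (1 + u) ≠ 0 := by linarith
  have h1v : (1 + v) ≠ 0 := by linarith
  rw [show -Z ^ 2 - Y ^ 2 = -(1 + u) by linarith [key2]]
  field_simp


/-! ### Polynomials in `v` of degree ≤ 5 and their derivatives -/

/-- Derivative of a quintic `c₀ + c₁v + ⋯ + c₅v⁵`. [folklore] -/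
theorem hasDerivAt_poly5 (c0 c1 c2 c3 c4 c5 v : ℝ) :
    HasDerivAt (fun v : ℝ => c0 + c1 * v + c2 * v ^ 2 + c3 * v ^ 3 + c4 * v ^ 4 + c5 * v ^ 5)
      (c1 + 2 * c2 * v + 3 * c3 * v ^ 2 + 4 * c4 * v ^ 3 + 5 * c5 * v ^ 4) v := by
  have h := (((((hasDerivAt_const v c0).add ((hasDerivAt_id v).const_mul c1)).add
    ((hasDerivAt_pow 2 v).const_mul c2)).add ((hasDerivAt_pow 3 v).const_mul c3)).add
    ((hasDerivAt_pow 4 v).const_mul c4)).add ((hasDerivAt_pow 5 v).const_mul c5)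
  refine (h.congr_of_eventuallyEq (Filter.Eventually.of_forall fun y => ?_)).congr_deriv ?_
  · simp only [Pi.add_apply, id]
  · push_cast; ring

/-! ### The square-root kernel `S(v) = √(1−v)√(u+v)` and the three arcsine antiderivatives -/

/-- `S(u,v) = √(1 − v)·√(u + v)` (so `S² = (1−v)(u+v)` and `√H = 4γS`). [folklore] -/
def Sv (u v : ℝ) : ℝ := √(1 - v) * √(u + v)

/-- `∂S/∂v = (1 − u − 2v)/(2S)`. [folklore] -/
theorem hasDerivAt_Sv {u v : ℝ} (hv : v < 1) (huv : 0 < u + v) :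
    HasDerivAt (Sv u) ((1 - u - 2 * v) / (2 * (√(1 - v) * √(u + v)))) v := by
  have hY : 0 < √(1 - v) := Real.sqrt_pos.mpr (by linarith)
  have hZ : 0 < √(u + v) := Real.sqrt_pos.mpr huv
  have hY2 : √(1 - v) ^ 2 = 1 - v := Real.sq_sqrt (by linarith)
  have hZ2 : √(u + v) ^ 2 = u + v := Real.sq_sqrt huv.le
  unfold Sv
  refine ((hasDerivAt_sqrt_one_sub hv).mul (hasDerivAt_sqrt_add huv)).congr_deriv ?_
  field_simp
  linear_combination hY2 - hZ2

/-- First arcsine argument `a₀ = (1 − u − 2v)/(1 + u)` (antiderivative of `−1/S`). [folklore] -/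
def a0f (u v : ℝ) : ℝ := (1 - u - 2 * v) / (1 + u)

/-- Second arcsine argument `a₁ = (1 − 3u − 3v + uv)/((1+v)(1+u))` (pole `v = −1`). [folklore] -/
def a1f (u v : ℝ) : ℝ := (1 - 3 * u - 3 * v + u * v) / ((1 + v) * (1 + u))

/-- Third arcsine argument `a₂ = (2 − u + u² − 3v + uv)/((2−u−v)(1+u))` (pole `v = 2 − u`).
[folklore] -/
def a2f (u v : ℝ) : ℝ := (2 - u + u ^ 2 - 3 * v + u * v) / ((2 - u - v) * (1 + u))

/-- Generic arcsine chain rule with an explicit positive `m = √(1 − a²)`. [folklore] -/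
theorem hasDerivAt_arcsin_of_sq {a : ℝ → ℝ} {a' m v : ℝ} (ha : HasDerivAt a a' v) (hm : 0 < m)
    (hma : m ^ 2 = 1 - a v ^ 2) : HasDerivAt (fun v => arcsin (a v)) (a' / m) v := by
  have hlt : a v ^ 2 < 1 := by nlinarith
  have hab : -1 < a v ∧ a v < 1 := by
    constructor <;> nlinarith [sq_nonneg (a v + 1), sq_nonneg (a v - 1)]
  have hsq : √(1 - a v ^ 2) = m := by
    rw [← hma, Real.sqrt_sq hm.le]
  have h := (Real.hasDerivAt_arcsin hab.1.ne' hab.2.ne).comp v ha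
  refine h.congr_deriv ?_
  rw [hsq]
  field_simp

/-- `∂/∂v arcsin a₀ = −1/S`. [folklore] -/
theorem hasDerivAt_arcsin_a0 {u v : ℝ} (hv : v < 1) (huv : 0 < u + v) :
    HasDerivAt (fun v => arcsin (a0f u v)) (-1 / (√(1 - v) * √(u + v))) v := by
  have hY : 0 < √(1 - v) := Real.sqrt_pos.mpr (by linarith)
  have hZ : 0 < √(u + v) := Real.sqrt_pos.mpr huv
  have hY2 : √(1 - v) ^ 2 = 1 - v := Real.sq_sqrt (by linarith)
  have hZ2 : √(u + v) ^ 2 = u + v := Real.sq_sqrt huv.le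
  have h1u : (1 + u) ≠ 0 := by linarith
  have ha : HasDerivAt (a0f u) (-2 / (1 + u)) v := by
    unfold a0f
    have := ((hasDerivAt_id v).const_mul (-2 : ℝ)).const_add (1 - u)
    refine (this.div_const (1 + u)).congr_of_eventuallyEq ?_ |>.congr_deriv ?_
    · exact Filter.Eventually.of_forall fun y => by simp only [id]; ring
    · simp
  have hm : 0 < 2 * (√(1 - v) * √(u + v)) / (1 + u) := div_pos (by positivity) (by linarith)
  refine (hasDerivAt_arcsin_of_sq ha hm ?_).congr_deriv ?_
  · unfold a0f
    rw [div_pow, div_pow, mul_pow, mul_pow, hY2, hZ2]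
    field_simp
    ring
  · field_simp

/-- `∂/∂v arcsin a₁ = −2γ/((1+v)S)`. [folklore] -/
theorem hasDerivAt_arcsin_a1 {u v : ℝ} (hu0 : 0 < u) (hu : u < 1) (hv0 : 0 < v) (hv : v < 1) :
    HasDerivAt (fun v => arcsin (a1f u v)) (-2 * gam u / ((1 + v) * (√(1 - v) * √(u + v)))) v := by
  have huv : 0 < u + v := by linarith
  have hY : 0 < √(1 - v) := Real.sqrt_pos.mpr (by linarith)
  have hZ : 0 < √(u + v) := Real.sqrt_pos.mpr huv
  have hg : 0 < gam u := gam_pos hu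
  have hY2 : √(1 - v) ^ 2 = 1 - v := Real.sq_sqrt (by linarith)
  have hZ2 : √(u + v) ^ 2 = u + v := Real.sq_sqrt huv.le
  have hg2 := gam_sq hu
  have h1u : (1 + u) ≠ 0 := by linarith
  have h1v : (1 + v) ≠ 0 := by linarith
  have ha : HasDerivAt (a1f u) (-4 * (1 - u) / ((1 + v) ^ 2 * (1 + u))) v := by
    unfold a1f
    have hN : HasDerivAt (fun v : ℝ => 1 - 3 * u - 3 * v + u * v) (-3 + u) v := by
      have := (((hasDerivAt_id v).const_mul (-3 : ℝ)).const_add (1 - 3 * u)).add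
        ((hasDerivAt_id v).const_mul u)
      refine (this.congr_of_eventuallyEq ?_).congr_deriv ?_
      · exact Filter.Eventually.of_forall fun y => by simp only [id, Pi.add_apply]; ring
      · simp
    have hD : HasDerivAt (fun v : ℝ => (1 + v) * (1 + u)) (1 + u) v := by
      simpa using ((hasDerivAt_id v).const_add 1).mul_const (1 + u)
    refine (hN.div hD (mul_ne_zero h1v h1u)).congr_deriv ?_
    field_simp
    ring
  have hm : 0 < 4 * gam u * (√(1 - v) * √(u + v)) / ((1 + u) * (1 + v)) := by positivity
  refine (hasDerivAt_arcsin_of_sq ha hm ?_).congr_deriv ?_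
  · unfold a1f
    rw [div_pow, div_pow, mul_pow, mul_pow, mul_pow, mul_pow, hY2, hZ2, hg2]
    field_simp
    ring
  · rw [show (1 - u) = 2 * gam u ^ 2 by rw [hg2]; ring]
    field_simp

/-- `∂/∂v arcsin a₂ = −2γ/((2−u−v)S)`. [folklore] -/
theorem hasDerivAt_arcsin_a2 {u v : ℝ} (hu0 : 0 < u) (hu : u < 1) (hv0 : 0 < v) (hv : v < 1) :
    HasDerivAt (fun v => arcsin (a2f u v))
      (-2 * gam u / ((2 - u - v) * (√(1 - v) * √(u + v)))) v := by
  have huv : 0 < u + v := by linarith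
  have hY : 0 < √(1 - v) := Real.sqrt_pos.mpr (by linarith)
  have hZ : 0 < √(u + v) := Real.sqrt_pos.mpr huv
  have hg : 0 < gam u := gam_pos hu
  have hY2 : √(1 - v) ^ 2 = 1 - v := Real.sq_sqrt (by linarith)
  have hZ2 : √(u + v) ^ 2 = u + v := Real.sq_sqrt huv.le
  have hg2 := gam_sq hu
  have h1u : (1 + u) ≠ 0 := by linarith
  have h2uv : (2 - u - v) ≠ 0 := by linarith
  have ha : HasDerivAt (a2f u) (-4 * (1 - u) / ((2 - u - v) ^ 2 * (1 + u))) v := by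
    unfold a2f
    have hN : HasDerivAt (fun v : ℝ => 2 - u + u ^ 2 - 3 * v + u * v) (-3 + u) v := by
      have := (((hasDerivAt_id v).const_mul (-3 : ℝ)).const_add (2 - u + u ^ 2)).add
        ((hasDerivAt_id v).const_mul u)
      refine (this.congr_of_eventuallyEq ?_).congr_deriv ?_
      · exact Filter.Eventually.of_forall fun y => by simp only [id, Pi.add_apply]; ring
      · simp
    have hD : HasDerivAt (fun v : ℝ => (2 - u - v) * (1 + u)) (-(1 + u)) v := by
      have := ((hasDerivAt_id v).const_sub (2 - u)).mul_const (1 + u)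
      refine (this.congr_of_eventuallyEq ?_).congr_deriv ?_
      · exact Filter.Eventually.of_forall fun y => by simp only [id]
      · simp
    refine (hN.div hD (mul_ne_zero h2uv h1u)).congr_deriv ?_
    field_simp
    ring
  have hm : 0 < 4 * gam u * (√(1 - v) * √(u + v)) / ((1 + u) * (2 - u - v)) :=
    div_pos (by positivity) (mul_pos (by linarith) (by linarith))
  refine (hasDerivAt_arcsin_of_sq ha hm ?_).congr_deriv ?_
  · unfold a2f
    rw [div_pow, div_pow, mul_pow, mul_pow, mul_pow, mul_pow, hY2, hZ2, hg2]
    field_simp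
    ring
  · rw [show (1 - u) = 2 * gam u ^ 2 by rw [hg2]; ring]
    field_simp


/-! ### The by-parts antiderivative of the opposite-side integrand -/

/-- `F₁(u,v) = −∫_v^1 (1−t²)(1−(u+t−1)²) dt` (antiderivative of `QR` vanishing at `v = 1`).
[folklore] -/
def F1o (u v : ℝ) : ℝ :=
  (-(11 / 30 : ℝ) - (5 / 6) * u + (2 / 3) * u ^ 2) + (2 * u - u ^ 2) * v + (1 - u) * v ^ 2 +
    (-(1 / 3 : ℝ) - (2 / 3) * u + (1 / 3) * u ^ 2) * v ^ 3 + (-(1 / 2 : ℝ) + (1 / 2) * u) * v ^ 4 +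
    (1 / 5 : ℝ) * v ^ 5

/-- `F₂(u,v) = −∫_v^1 (1−(u+t−1)²) dt`. [folklore] -/
def F2o (u v : ℝ) : ℝ :=
  (-(2 / 3 : ℝ) - u + u ^ 2) + (2 * u - u ^ 2) * v + (1 - u) * v ^ 2 + (-(1 / 3 : ℝ)) * v ^ 3 +
    0 * v ^ 4 + 0 * v ^ 5

/-- `F₃(v) = −∫_v^1 (1−t²) dt = v − v³/3 − 2/3`. [folklore] -/
def F3o (v : ℝ) : ℝ :=
  (-(2 / 3 : ℝ)) + 1 * v + 0 * v ^ 2 + (-(1 / 3 : ℝ)) * v ^ 3 + 0 * v ^ 4 + 0 * v ^ 5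

/-- The polynomial multiplying `S` in the algebraic part of the antiderivative. [folklore] -/
def PSo (u v : ℝ) : ℝ :=
  ((3 / 5 : ℝ) - (2 / 15) * u - (16 / 15) * u ^ 2 + (3 / 5) * u ^ 3) +
    (-(1 : ℝ) - (4 / 3) * u + (7 / 5) * u ^ 2) * v + (-(3 / 5 : ℝ) + (3 / 5) * u) * v ^ 2 +
    (2 / 5 : ℝ) * v ^ 3 + 0 * v ^ 4 + 0 * v ^ 5

/-- Coefficient of `arcsin a₀`. [folklore] -/
def cIo (u : ℝ) : ℝ := (12 / 5 : ℝ) - (32 / 15) * u - (4 / 15) * u ^ 2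

/-- Coefficient of `arcsin a₁` (residue at the pole `v = −1`). [folklore] -/
def alo (u : ℝ) : ℝ := -(8 / 5 : ℝ) + (8 / 3) * u

/-- Coefficient of `arcsin a₂` (residue at the pole `v = 2 − u`). [folklore] -/
def beo (u : ℝ) : ℝ :=
  -(13 / 10 : ℝ) + (17 / 6) * u - u ^ 2 - u ^ 3 + (1 / 6) * u ^ 4 + (3 / 10) * u ^ 5

/-- **The opposite-side integrand** `k_o(u,v) = QR·A + PR·B + PQ·C − (P+Q+R)·√H/4` with
`P = 1−u²`, `Q = 1−v²`, `R = 1−(u+v−1)²`, `√H = 4γS`. [folklore] -/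
def kOpp (u v : ℝ) : ℝ :=
  (1 - v ^ 2) * (1 - (u + v - 1) ^ 2) * angAo u v +
    (1 - u ^ 2) * (1 - (u + v - 1) ^ 2) * angBo u v +
    (1 - u ^ 2) * (1 - v ^ 2) * angCo u v -
    ((1 - u ^ 2) + (1 - v ^ 2) + (1 - (u + v - 1) ^ 2)) * gam u * Sv u v

/-- **Antiderivative in `v` of the opposite-side integrand** (integration by parts on the three
angle terms, then the algebraic remainder in closed form). [folklore] -/
def FinOpp (u v : ℝ) : ℝ :=
  F1o u v * angAo u v + (1 - u ^ 2) * F2o u v * angBo u v + (1 - u ^ 2) * F3o v * angCo u v +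
    gam u * (PSo u v * Sv u v + cIo u * arcsin (a0f u v)) +
    (alo u * arcsin (a1f u v) + beo u * arcsin (a2f u v)) / 2

/-- **`∂FinOpp/∂v = k_o`** on the open square `(1/2,1)²`. [folklore] -/
theorem hasDerivAt_FinOpp {u v : ℝ} (hu : u ∈ Ioo (1 / 2 : ℝ) 1) (hv : v ∈ Ioo (1 / 2 : ℝ) 1) :
    HasDerivAt (FinOpp u) (kOpp u v) v := by
  obtain ⟨hu0, hu1⟩ := hu
  obtain ⟨hv0, hv1⟩ := hv
  have huv : 0 < u + v := by linarith
  have hY : 0 < √(1 - v) := Real.sqrt_pos.mpr (by linarith)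
  have hZ : 0 < √(u + v) := Real.sqrt_pos.mpr huv
  have hg : 0 < gam u := gam_pos hu1
  have hY2 : √(1 - v) ^ 2 = 1 - v := Real.sq_sqrt (by linarith)
  have hZ2 : √(u + v) ^ 2 = u + v := Real.sq_sqrt huv.le
  have hg2 := gam_sq hu1
  have h1u : (1 + u) ≠ 0 := by linarith
  have h1v : (1 + v) ≠ 0 := by linarith
  have h2uv : (2 - u - v) ≠ 0 := by linarith
  -- derivatives of the pieces
  have dF1 : HasDerivAt (F1o u) ((2 * u - u ^ 2) + 2 * (1 - u) * v +
      3 * (-(1 / 3 : ℝ) - (2 / 3) * u + (1 / 3) * u ^ 2) * v ^ 2 +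
      4 * (-(1 / 2 : ℝ) + (1 / 2) * u) * v ^ 3 +
      5 * (1 / 5 : ℝ) * v ^ 4) v := hasDerivAt_poly5 _ _ _ _ _ _ v
  have dF2 : HasDerivAt (F2o u) ((2 * u - u ^ 2) + 2 * (1 - u) * v + 3 * (-(1 / 3 : ℝ)) * v ^ 2 +
      4 * 0 * v ^ 3 + 5 * 0 * v ^ 4) v := hasDerivAt_poly5 _ _ _ _ _ _ v
  have dF3 : HasDerivAt F3o
      (1 + 2 * 0 * v + 3 * (-(1 / 3 : ℝ)) * v ^ 2 + 4 * 0 * v ^ 3 + 5 * 0 * v ^ 4) v :=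
    hasDerivAt_poly5 _ _ _ _ _ _ v
  have dPS : HasDerivAt (PSo u) ((-(1 : ℝ) - (4 / 3) * u + (7 / 5) * u ^ 2) +
      2 * (-(3 / 5 : ℝ) + (3 / 5) * u) * v + 3 * (2 / 5 : ℝ) * v ^ 2 + 4 * 0 * v ^ 3 +
      5 * 0 * v ^ 4) v :=
    hasDerivAt_poly5 _ _ _ _ _ _ v
  have dA := hasDerivAt_angAo hu1 hv1 huv
  have dB := hasDerivAt_angBo hu1 hv1 huv
  have dC := hasDerivAt_angCo hu1 hv1 huv
  have dS := hasDerivAt_Sv (u := u) hv1 huv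
  have da0 := hasDerivAt_arcsin_a0 (u := u) hv1 huv
  have da1 := hasDerivAt_arcsin_a1 (by linarith) hu1 (by linarith) hv1
  have da2 := hasDerivAt_arcsin_a2 (by linarith) hu1 (by linarith) hv1
  have hsum := (((dF1.mul dA).add (((dF2.mul dB)).const_mul (1 - u ^ 2))).add
    ((dF3.mul dC).const_mul (1 - u ^ 2))).add
    ((((dPS.mul dS).add (da0.const_mul (cIo u))).const_mul (gam u))) |>.add
    (((da1.const_mul (alo u)).add (da2.const_mul (beo u))).div_const 2)
  have hfun : FinOpp u = fun x => F1o u x * angAo u x + (1 - u ^ 2) * (F2o u x * angBo u x) +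
      (1 - u ^ 2) * (F3o x * angCo u x) +
      gam u * (PSo u x * Sv u x + cIo u * arcsin (a0f u x)) +
      (alo u * arcsin (a1f u x) + beo u * arcsin (a2f u x)) / 2 := by
    funext x; simp only [FinOpp]; ring
  rw [hfun]
  refine hsum.congr_deriv ?_
  -- the algebra: everything that is not an angle is `γ/S` times a rational function of `(u,v)`
  set Y := √(1 - v) with hYdef
  set Z := √(u + v) with hZdef
  set g := gam u with hgdef
  set A := angAo u v
  set B := angBo u v
  set C := angCo u v
  set L := F1o u v * (u + 2 * v - 1) / ((1 + v) * (2 - u - v)) -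
      (1 - u ^ 2) * F2o u v / (2 - u - v) +
      (1 - u ^ 2) * F3o v / (1 + v) + PSo u v * (1 - u - 2 * v) / 2 - cIo u - alo u / (1 + v) -
      beo u / (2 - u - v) +
      (((-(1 : ℝ) - (4 / 3) * u + (7 / 5) * u ^ 2) + 2 * (-(3 / 5 : ℝ) + (3 / 5) * u) * v +
        3 * (2 / 5 : ℝ) * v ^ 2 + 4 * 0 * v ^ 3 + 5 * 0 * v ^ 4) +
        ((1 - u ^ 2) + (1 - v ^ 2) + (1 - (u + v - 1) ^ 2))) * (Y ^ 2 * Z ^ 2) with hL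
  have hpoly : L = 0 := by
    rw [hL, hY2, hZ2]
    simp only [F1o, F2o, F3o, PSo, cIo, alo, beo]
    field_simp
    ring
  have hSv : Sv u v = Y * Z := rfl
  rw [show kOpp u v = kOpp u v + g / (Y * Z) * L by rw [hpoly]; ring]
  simp only [kOpp, hSv, hL]
  field_simp
  ring


/-! ### The definite inner integral -/

/-- `FinOpp u` is continuous on `[1/2, 1]` (all arguments stay in the domains of continuity;
the only degeneracy, `√(1 − v) = 0` at `v = 1`, is harmless). [folklore] -/
theorem continuousOn_FinOpp {u : ℝ} (hu : u ∈ Ioo (1 / 2 : ℝ) 1) :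
    ContinuousOn (FinOpp u) (Icc (1 / 2 : ℝ) 1) := by
  obtain ⟨hu0, hu1⟩ := hu
  have hg : 0 < gam u := gam_pos hu1
  have hgne : gam u ≠ 0 := hg.ne'
  have h1u : (1 + u) ≠ 0 := by linarith
  unfold FinOpp angAo angBo angCo Sv a0f a1f a2f F1o F2o F3o PSo
  apply ContinuousOn.add
  · apply ContinuousOn.add
    · apply ContinuousOn.add
      · apply ContinuousOn.add
        · fun_prop
        · apply ContinuousOn.mul (by fun_prop)
          apply Continuous.comp_continuousOn Real.continuous_arctan
          apply ContinuousOn.div (by fun_prop) (by fun_prop)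
          intro x hx
          exact mul_ne_zero hgne (Real.sqrt_pos.mpr (by linarith [hx.1])).ne'
      · apply ContinuousOn.mul (by fun_prop)
        apply ContinuousOn.sub continuousOn_const
        apply Continuous.comp_continuousOn Real.continuous_arctan
        apply ContinuousOn.div (by fun_prop) (by fun_prop)
        intro x hx
        exact (Real.sqrt_pos.mpr (by linarith [hx.1])).ne'
    · fun_prop
  · apply ContinuousOn.div_const
    apply ContinuousOn.add
    · apply ContinuousOn.mul continuousOn_const
      apply Continuous.comp_continuousOn Real.continuous_arcsin
      apply ContinuousOn.div (by fun_prop) (by fun_prop)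
      intro x hx
      exact mul_ne_zero (by linarith [hx.1]) h1u
    · apply ContinuousOn.mul continuousOn_const
      apply Continuous.comp_continuousOn Real.continuous_arcsin
      apply ContinuousOn.div (by fun_prop) (by fun_prop)
      intro x hx
      exact mul_ne_zero (by linarith [hx.2]) h1u

/-- `kOpp u` is continuous on `[1/2, 1]`. [folklore] -/
theorem continuousOn_kOpp {u : ℝ} (hu : u ∈ Ioo (1 / 2 : ℝ) 1) :
    ContinuousOn (kOpp u) (Icc (1 / 2 : ℝ) 1) := by
  obtain ⟨hu0, hu1⟩ := hu
  have hg : 0 < gam u := gam_pos hu1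
  have hgne : gam u ≠ 0 := hg.ne'
  unfold kOpp angAo angBo angCo Sv
  apply ContinuousOn.sub
  · apply ContinuousOn.add
    · apply ContinuousOn.add
      · fun_prop
      · apply ContinuousOn.mul (by fun_prop)
        apply Continuous.comp_continuousOn Real.continuous_arctan
        apply ContinuousOn.div (by fun_prop) (by fun_prop)
        intro x hx
        exact mul_ne_zero hgne (Real.sqrt_pos.mpr (by linarith [hx.1])).ne'
    · apply ContinuousOn.mul (by fun_prop)
      apply ContinuousOn.sub continuousOn_const
      apply Continuous.comp_continuousOn Real.continuous_arctan
      apply ContinuousOn.div (by fun_prop) (by fun_prop)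
      intro x hx
      exact (Real.sqrt_pos.mpr (by linarith [hx.1])).ne'
  · fun_prop

/-- **The opposite-side inner integral by the fundamental theorem of calculus**:
`∫_{1/2}^1 k_o(u,v) dv = FinOpp u 1 − FinOpp u (1/2)`. [folklore] -/
theorem integral_kOpp {u : ℝ} (hu : u ∈ Ioo (1 / 2 : ℝ) 1) :
    ∫ v in (1 / 2 : ℝ)..1, kOpp u v = FinOpp u 1 - FinOpp u (1 / 2) :=
  integral_eq_sub_of_hasDerivAt_of_le (by norm_num) (continuousOn_FinOpp hu)
    (fun v hv => hasDerivAt_FinOpp hu hv)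
    ((continuousOn_kOpp hu).intervalIntegrable_of_Icc (by norm_num))

/-- Value of the antiderivative at `v = 1`: all polynomial prefactors and `S` vanish and the
three arcsines equal `−π/2`. [folklore] -/
theorem FinOpp_one {u : ℝ} (hu : u ∈ Ioo (1 / 2 : ℝ) 1) :
    FinOpp u 1 = -(π / 2) * (gam u * cIo u + (alo u + beo u) / 2) := by
  obtain ⟨hu0, hu1⟩ := hu
  have h1u : (1 + u) ≠ 0 := by linarith
  have h1u' : (1 - u) ≠ 0 := by linarith
  have hF1 : F1o u 1 = 0 := by simp only [F1o]; ring
  have hF2 : F2o u 1 = 0 := by simp only [F2o]; ring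
  have hF3 : F3o 1 = 0 := by simp only [F3o]; ring
  have hS : Sv u 1 = 0 := by simp [Sv]
  have ha0 : a0f u 1 = -1 := by simp only [a0f]; field_simp; ring
  have ha1 : a1f u 1 = -1 := by simp only [a1f]; field_simp; ring
  have ha2 : a2f u 1 = -1 := by
    simp only [a2f]
    rw [div_eq_iff (mul_ne_zero (by linarith) h1u)]
    ring
  rw [FinOpp, hF1, hF2, hF3, hS, ha0, ha1, ha2, Real.arcsin_neg, Real.arcsin_one]
  ring

end BoltzmannB4.TwoCentre

end Literature.MathematicalPhysics.StatisticalMechanics
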